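import Literature.Probability.RandomPlanarGeometry.SLEKappaRhoFillVersion
import Literature.Probability.RandomPlanarGeometry.SLEKappaRhoProofs
import HarnessLib

/-!
# [LSW] Theorem 8.4 assembled per driving pair, and from the weakest forms of its leaves

Assembly file for the named fact
`Literature.Probability.RandomPlanarGeometry.SLEKappaRho.isRightRestrictionMeasure_fill` (file
`SLEKappaRho`; decomposition in `SLEKappaRhoRestriction`, `SLEKappaRhoRestrictionProofs`,
`SLEKappaRhoFillVersion`, `SLEKappaRhoProofs`), after

* G. F. Lawler, O. Schramm, W. Werner, *Conformal restriction: the chordal case*, J. Amer. Math.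
  Soc. **16** (2003) 917–955, arXiv:math/0209343 (**[LSW]**), §8.3 (SLE(κ, ρ), p. 36), Lemma 8.3
  (p. 36) and its proof, Thm. 8.4 (p. 37) and its proof (§8.4, p. 38).

State of the decomposition before this file: the law form of Thm. 8.4 follows from FIVE named
facts (`SLEKappaRho.isRightRestrictionMeasure_fill_of_five_leaves`, `SLEKappaRhoRestrictionProofs`,
fed with `SLEKappaRho.exists_measurable_fill_version_of_restriction_leaves`, `SLEKappaRhoFillVersion`):

1. `SLEKappaRho.integral_inv_eq` — §8.3: "`∫₀ᵗ du/Z_u = (Z_t − √κ B_t)/(ρ + 2) < ∞` for all `t`";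
2. `SLEKappaRho.exists_isOneSidedMartingale` — Lemmas 8.9–8.10 (the martingale `M`);
3. `Loewner.restrictionDeriv_exitTime_gt` — Lemma 6.2;
4. `IsSmoothHull.restrictionDerivVanishesAtHit` — Lemma 6.3;
5. `SLEKappaRho.swallowingTime_ofReal` — Lemma 8.3 (2) AND (3).

The proof of Thm. 8.4 uses facts 1 and 5 only partially: of §8.3's displayed sentence it uses the
finiteness "`∫₀ᵗ du/Z_u < ∞` for all `t`" (which makes the paths of `(O, W)` continuous), not
the identity; of Lemma 8.3 it uses part (2)'s conclusion for positive points, "a.s. `1 ∉ K_t` for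
all `t ≥ 0` […] `K_∞ ∩ (0, ∞) = ∅`" (p. 36, the common part of the proofs of (2) and (3)), not
part (3) ("if `ρ < ρ₀` then `K_∞ ∩ ℝ = (−∞, 0]`", the swallowing of the negative axis). This file

* vendors these two printed sub-statements as named facts —
  `SLEKappaRho.intervalIntegrable_inv` (§8.3, "`∫₀ᵗ du/Z_u < ∞` for all `t ≥ 0`") and
  `SLEKappaRho.swallowingTime_ofReal_pos` (Lemma 8.3, proof of (2)–(3): "`K_∞ ∩ (0, ∞) = ∅`
  a.s." for `κ ≤ 4`) — each PROVED to follow from the fact it weakens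
  (`SLEKappaRho.intervalIntegrable_inv_of`, `SLEKappaRho.swallowingTime_ofReal_pos_of`);
* re-runs the end of the proof of Thm. 8.4 PER DRIVING PAIR: the sample-path inputs that the
  printed argument consumes for ONE SLE(8/3, ρ) driving process `W` are bundled in
  `SLEKappaRho.PairLeaves ρ W` (the martingales of Lemmas 8.9–8.10 for all smooth `A ∈ 𝒬₊`;
  a.s. continuity of the paths; `W_0 = 0`; Lemma 8.3 (4): `K_∞` unbounded; Lemma 8.3 (2):
  no positive real point swallowed), and from `PairLeaves ρ W` with Lemmas 6.2 and 6.3 the whole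
  chain of `SLEKappaRhoRestriction`/`…Proofs`/`…FillVersion` is derived for that pair:
  `P[T_A = ∞] = Φ_A'(0)^α` for smooth `A` (`PairLeaves.measure_hullHitTime_eq_top`), the
  non-accumulation of the hulls on `(0, ∞)` (`PairLeaves.ae_ofReal_notMem_closure_hullUnion`)
  and on a smooth `A` on `{T_A = ∞}` (`PairLeaves.ae_disjoint_closure_of_hullHitTime_eq_top`,
  the closure paragraph, by the argument of `SLEKappaRhoRestrictionProofs`), the avoidance
  formula for all `A ∈ 𝒬₊` (`PairLeaves.measure_fill_disjoint`), the measurable `Ω₊`-valued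
  version of `K = F^{ℝ₊}_ℍ(cl K_∞)` (`IsSLEKappaRhoPair.exists_measurable_fill_version_of`) and
  the law statement (`IsSLEKappaRhoPair.isRightRestrictionMeasure_map_of`);
* concludes **[LSW] Thm. 8.4 from the weakest leaves**
  (`SLEKappaRho.isRightRestrictionMeasure_fill_of_weak_leaves`): `SLEKappaRho.intervalIntegrable_inv`,
  `SLEKappaRho.exists_isOneSidedMartingale`, `Loewner.restrictionDeriv_exitTime_gt`,
  `IsSmoothHull.restrictionDerivVanishesAtHit`, `SLEKappaRho.swallowingTime_ofReal_pos` — Lemma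
  8.3 (4) being PROVED in the tree (`SLEKappaRho.not_isBounded_hullUnion_holds`,
  `SLEKappaRhoProofs`); the five-leaf form with the original leaves is the tree's
  `SLEKappaRho.isRightRestrictionMeasure_fill_of_five_restriction_leaves` (`SLEKappaRhoFillVersion`),
  which also follows from the weak form through `SLEKappaRho.intervalIntegrable_inv_of` and
  `SLEKappaRho.swallowingTime_ofReal_pos_of`.
-/

noncomputable section

open Set Filter Topology MeasureTheory Metric Bornology
open UpperHalfPlane (upperHalfPlaneSet)
open scoped NNReal ENNReal
open Literature.Analysis.FunctionSpaces (IsBesselProcess IsSquaredBesselProcess IsStrongSolution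
  IsItoProcess intervalIntegrable_of_forall_integrableOn_Icc)
open Literature.Probability.Process (preWienerMeasure brownian continuous_brownian)

namespace Literature.Probability.RandomPlanarGeometry

/-! ### The two printed sub-statements, as named facts, and their derivation from the stronger leaves -/

/-- NAMED FACT — **`∫₀ᵗ du/Z_u < ∞` for all `t ≥ 0`, almost surely** ([LSW] §8.3, definition
of SLE(κ, ρ), p. 36: "`Z_t` is `√κ` times a `d`-dimensional Bessel process where
`d = 1 + 2(ρ + 2)/κ`. It is well-known (e.g., [RY]) that this process is well-defined (for all
`ρ > −2` and all `t ≥ 0`). Note also that `∫₀ᵗ du/Z_u = (Z_t − √κ B_t)/(ρ + 2) < ∞` for all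
`t ≥ 0`"): the FINITENESS half of the displayed sentence — for `κ > 0`, `ρ > −2` and an
SLE(κ, ρ) driving pair `(O, W)` (`IsSLEKappaRhoPair`; `Z = W − O = √κ X`), almost surely, for
every `t`, `u ↦ 1/Z_u` is integrable on `[0, t]`. This is the first conjunct of the named fact
`SLEKappaRho.integral_inv_eq` (`SLEKappaRhoRestriction`, which also records the identity), and
it is all that the proof of Thm. 8.4 uses of that sentence (it makes `O_t = −2 ∫₀ᵗ du/Z_u`, hence
`W`, continuous in `t`). For the Bessel process `X` of dimension `d > 1` started at `0` this is
`∫₀ᵗ du/X_u < ∞` a.s. (Revuz–Yor, Ch. XI §1, Exercise (1.26)).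
[cite: LawlerSchrammWerner2003Restriction, §8.3 (definition of SLE(κ, ρ): ∫₀ᵗ du/Z_u < ∞ for all t ≥ 0, p. 36)] -/
def SLEKappaRho.intervalIntegrable_inv : Prop :=
  ∀ {κ : ℝ≥0} {ρ : ℝ} {O W : ℝ≥0 → (ℝ≥0 → ℝ) → ℝ}, 0 < κ → -2 < ρ → IsSLEKappaRhoPair κ ρ O W →
    ∀ᵐ ω ∂preWienerMeasure, ∀ t : ℝ≥0,
      IntervalIntegrable (fun u : ℝ ↦ (W u.toNNReal ω - O u.toNNReal ω)⁻¹) volume 0 t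

/-- The finiteness statement is the first half of `SLEKappaRho.integral_inv_eq`. [cite: LawlerSchrammWerner2003Restriction, §8.3 (p. 36)] -/
theorem SLEKappaRho.intervalIntegrable_inv_of (h : SLEKappaRho.integral_inv_eq) :
    SLEKappaRho.intervalIntegrable_inv :=
  fun hκ hρ hOW ↦ (h hκ hρ hOW).mono fun _ hω t ↦ (hω t).1

/-- NAMED FACT — **[LSW] Lemma 8.3, positive points are never swallowed** (p. 36; the common
part of parts (2) and (3) and of their proofs): for `κ > 0`, `κ ≤ 4`, `ρ > −2` and the hulls
`K_t` of SLE(κ, ρ), "a.s. `1 ∉ K_t` for all `t ≥ 0`. This also implies that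
`K_t ∩ [1, ∞) = ∅` a.s. for all `t ≥ 0`, since `K_t ∩ ℝ` is an interval. Scale invariance then
implies `K_∞ ∩ (0, ∞) = ∅` a.s." — equivalently (2) "if `ρ ≥ ρ₀` then a.s. `K_∞ ∩ ℝ = {0}`"
and (3) "if `ρ < ρ₀` then a.s. `K_∞ ∩ ℝ = (−∞, 0]`" restricted to the positive axis. With
[LSW]'s closed hulls read through the tree's swallowing times of real points (as in
`SLEKappaRho.swallowingTime_ofReal`, of which this is the first of three clauses): almost
surely no `x > 0` is ever swallowed. This is the only part of Lemma 8.3 (2)–(3) that the proof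
of Thm. 8.4 uses ("Recall that `A` is a smooth hull in `𝒬₊` and that `K_∞ ∩ (0, ∞) = ∅`",
§8.4 p. 38). Proof in print: comparison of `g_t(1) − W_t` with a Bessel process.
[cite: LawlerSchrammWerner2003Restriction, Lemma 8.3 (2)–(3) and their proof (p. 36: K_∞ ∩ (0, ∞) = ∅ a.s.)] -/
def SLEKappaRho.swallowingTime_ofReal_pos : Prop :=
  ∀ {κ : ℝ≥0} {ρ : ℝ} {O W : ℝ≥0 → (ℝ≥0 → ℝ) → ℝ}, 0 < κ → κ ≤ 4 → -2 < ρ →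
    IsSLEKappaRhoPair κ ρ O W →
      ∀ᵐ ω ∂preWienerMeasure, ∀ x : ℝ, 0 < x → Loewner.swallowingTime (fun t ↦ W t ω) x = ⊤

/-- The positive-axis statement is the first clause of `SLEKappaRho.swallowingTime_ofReal`.
[cite: LawlerSchrammWerner2003Restriction, Lemma 8.3 (2)–(3) (p. 36)] -/
theorem SLEKappaRho.swallowingTime_ofReal_pos_of (h : SLEKappaRho.swallowingTime_ofReal) :
    SLEKappaRho.swallowingTime_ofReal_pos :=
  fun hκ hκ4 hρ hOW ↦ (h hκ hκ4 hρ hOW).mono fun _ hω x hx ↦ (hω x).1 hx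

/-- Lemma 8.3 (2) at `κ = 8/3` from the positive-axis fact: a.s. no positive real point is ever
swallowed by the SLE(8/3, ρ) chain. [cite: LawlerSchrammWerner2003Restriction, Lemma 8.3 (2)–(3) (p. 36)] -/
theorem SLEKappaRho.ae_swallowingTime_ofReal_eq_top_of_pos (h83 : SLEKappaRho.swallowingTime_ofReal_pos)
    {ρ : ℝ} {O W : ℝ≥0 → (ℝ≥0 → ℝ) → ℝ} (hρ : -2 < ρ) (hOW : IsSLEKappaRhoPair (8 / 3) ρ O W) :
    ∀ᵐ ω ∂preWienerMeasure, ∀ x : ℝ, 0 < x → Loewner.swallowingTime (fun s ↦ W s ω) x = ⊤ := by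
  have hκ0 : (0 : ℝ≥0) < 8 / 3 := by positivity
  have hκ4 : (8 : ℝ≥0) / 3 ≤ 4 := by
    rw [div_le_iff₀ (by norm_num : (0 : ℝ≥0) < 3)]
    norm_num
  exact h83 hκ0 hκ4 hρ hOW

/-! ### Continuity of the paths from the finiteness of `∫₀ᵗ du/Z_u` -/

namespace IsSLEKappaRhoPair

variable {κ : ℝ≥0} {ρ : ℝ} {O W : ℝ≥0 → (ℝ≥0 → ℝ) → ℝ}

/-- **The paths of an SLE(κ, ρ) driving pair are a.s. continuous, from `∫₀ᵗ du/Z_u < ∞`**: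
on a sample path on which `u ↦ 1/Z_u` is integrable on every `[0, t]` and `Z = √κ X` is
continuous (a.e. path: `X` is the square root of an Itô process), `O_t = −2 ∫₀ᵗ du/Z_u` is a
continuous primitive (`intervalIntegral.continuous_primitive`) and `W = Z + O`.
[cite: LawlerSchrammWerner2003Restriction, §8.3 (definition of SLE(κ, ρ): ∫₀ᵗ du/Z_u < ∞ for all t ≥ 0, p. 36)] -/
theorem ae_continuous_of_intervalIntegrable (hfin : SLEKappaRho.intervalIntegrable_inv) (hκ : 0 < κ)
    (hρ : -2 < ρ) (h : IsSLEKappaRhoPair κ ρ O W) :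
    ∀ᵐ ω ∂preWienerMeasure, Continuous (fun t ↦ W t ω) ∧ Continuous (fun t ↦ O t ω) := by
  obtain ⟨X, ⟨Z, hZ, hXZ⟩, hO, hW⟩ := h
  have hZc := (IsStrongSolution.isItoProcess hZ).ae_continuous
  have hX0 : ∀ ω, X 0 ω = 0 := fun ω ↦ by
    have := IsBesselProcess.apply_zero ⟨Z, hZ, hXZ⟩ ω
    simpa using this
  filter_upwards [hfin hκ hρ ⟨X, ⟨Z, hZ, hXZ⟩, hO, hW⟩, hZc] with ω hI hZω
  have hXc : Continuous fun t ↦ X t ω := by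
    have : (fun t ↦ X t ω) = fun t ↦ Real.sqrt (Z t ω) := funext fun t ↦ hXZ t ω
    rw [this]
    exact Real.continuous_sqrt.comp hZω
  set f : ℝ → ℝ := fun u ↦ (Real.sqrt κ * X u.toNNReal ω)⁻¹ with hf
  -- the integrand of the fact is `f`
  have hfW : (fun u : ℝ ↦ (W u.toNNReal ω - O u.toNNReal ω)⁻¹) = f := by
    funext u
    rw [hf, hW u.toNNReal ω]
    ring_nf
  have hfneg : ∀ s ≤ 0, f s = f 0 := fun s hs ↦ by
    simp [hf, Real.toNNReal_of_nonpos hs]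
  have hint : ∀ t : ℝ≥0, IntegrableOn f (Icc 0 (t : ℝ)) := fun t ↦ by
    have h1 := hI t
    rw [hfW] at h1
    exact Iff.mpr integrableOn_Icc_iff_integrableOn_Ioc
      ((intervalIntegrable_iff_integrableOn_Ioc_of_le t.coe_nonneg).1 h1)
  have hii : ∀ a c, IntervalIntegrable f volume a c :=
    intervalIntegrable_of_forall_integrableOn_Icc hfneg hint
  have hF : Continuous fun t : ℝ≥0 ↦ ∫ u in (0 : ℝ)..(t : ℝ), f u :=
    (intervalIntegral.continuous_primitive hii 0).comp NNReal.continuous_coe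
  have hOc : Continuous fun t ↦ O t ω := by
    have : (fun t ↦ O t ω) = fun t : ℝ≥0 ↦ -2 * ∫ u in (0 : ℝ)..(t : ℝ), f u :=
      funext fun t ↦ hO t ω
    rw [this]
    exact continuous_const.mul hF
  refine ⟨?_, hOc⟩
  have : (fun t ↦ W t ω) = fun t ↦ Real.sqrt κ * X t ω + O t ω := funext fun t ↦ hW t ω
  rw [this]
  exact (continuous_const.mul hXc).add hOc

end IsSLEKappaRhoPair

/-! ### The sample-path inputs of the end of the proof of Thm. 8.4, for one driving process -/

/-- **The inputs of the end of the proof of [LSW] Thm. 8.4 for ONE driving process** `W` (time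
first, on the canonical space) and the exponent `α(ρ)`: a hypothesis bundle (not asserted),
collecting what the printed argument (§8.4 p. 38) consumes about the SLE(8/3, ρ) driving process —
the martingale `M` of Lemmas 8.9–8.10 for every smooth `A ∈ 𝒬₊` (`SLEKappaRho.IsOneSidedMartingale`,
file `SLEKappaRhoRestriction`); continuity of the paths (§8.3, `∫₀ᵗ du/Z_u < ∞`); `W_0 = 0`;
Lemma 8.3 (4) ("`K_∞` is a.s. unbounded"); Lemma 8.3 (2) on the positive axis ("`K_∞ ∩ (0, ∞) = ∅`":
no `x > 0` is ever swallowed). The deterministic Lemmas 6.2 and 6.3 are kept as separate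
hypotheses of the theorems below. For SLE(8/3, ρ) pairs it is supplied by the named facts
(`SLEKappaRho.pairLeaves_of`). [cite: LawlerSchrammWerner2003Restriction, end of the proof of Thm. 8.4 (§8.4 p. 38) with Lemma 8.3 (p. 36) and §8.3 (p. 36)] -/
structure SLEKappaRho.PairLeaves (ρ : ℝ) (W : ℝ≥0 → (ℝ≥0 → ℝ) → ℝ) : Prop where
  /-- Lemmas 8.9–8.10: the one-sided restriction martingale exists for every smooth `A ∈ 𝒬₊`. -/
  exists_martingale : ∀ {A : Set ℂ}, IsSmoothHull A → IsPlusHull A →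
    ∃ M, SLEKappaRho.IsOneSidedMartingale ρ A W M
  /-- The paths of `W` are a.s. continuous. -/
  ae_continuous : ∀ᵐ ω ∂preWienerMeasure, Continuous fun s ↦ W s ω
  /-- `W_0 = 0`. -/
  apply_zero : ∀ ω, W 0 ω = 0
  /-- Lemma 8.3 (4): `K_∞ = ⋃_t K_t` is a.s. unbounded. -/
  ae_not_isBounded : ∀ᵐ ω ∂preWienerMeasure, ¬ IsBounded (Loewner.hullUnion fun s ↦ W s ω)
  /-- Lemma 8.3 (2), positive axis: a.s. no `x > 0` is ever swallowed. -/
  ae_swallowingTime_eq_top : ∀ᵐ ω ∂preWienerMeasure, ∀ x : ℝ, 0 < x →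
    Loewner.swallowingTime (fun s ↦ W s ω) x = ⊤

/-- **The bundle for SLE(8/3, ρ) driving pairs from the (weak) named facts**: the martingales
from `SLEKappaRho.exists_isOneSidedMartingale`, continuity from `SLEKappaRho.intervalIntegrable_inv`
(`IsSLEKappaRhoPair.ae_continuous_of_intervalIntegrable`), `W_0 = 0` by construction, Lemma 8.3 (4)
PROVED (`SLEKappaRho.not_isBounded_hullUnion_holds`, `SLEKappaRhoProofs`), and Lemma 8.3 (2) on the
positive axis from `SLEKappaRho.swallowingTime_ofReal_pos`.
[cite: LawlerSchrammWerner2003Restriction, §8.3–8.4 (pp. 36–38)] -/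
theorem SLEKappaRho.pairLeaves_of (hfin : SLEKappaRho.intervalIntegrable_inv)
    (hM : SLEKappaRho.exists_isOneSidedMartingale) (h83 : SLEKappaRho.swallowingTime_ofReal_pos)
    {ρ : ℝ} {O W : ℝ≥0 → (ℝ≥0 → ℝ) → ℝ} (hρ : -2 < ρ) (hOW : IsSLEKappaRhoPair (8 / 3) ρ O W) :
    SLEKappaRho.PairLeaves ρ W where
  exists_martingale hAs hA := hM hρ hOW hAs hA
  ae_continuous := (hOW.ae_continuous_of_intervalIntegrable hfin (by positivity) hρ).mono fun _ h ↦ h.1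
  apply_zero := hOW.snd_zero
  ae_not_isBounded := SLEKappaRho.not_isBounded_hullUnion_holds (by positivity) hρ hOW
  ae_swallowingTime_eq_top := SLEKappaRho.ae_swallowingTime_ofReal_eq_top_of_pos h83 hρ hOW

namespace SLEKappaRho.PairLeaves

variable {ρ : ℝ} {W : ℝ≥0 → (ℝ≥0 → ℝ) → ℝ} {A : Set ℂ}

/-- **`P[T_A = ∞] = Φ_A'(0)^α` for a smooth hull `A ∈ 𝒬₊`**, per driving process — the end of
the proof of [LSW] Thm. 8.4 (`SLEKappaRho.IsOneSidedMartingale.measure_hullHitTime_eq_top_of_tendsto`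
with `….ae_tendsto_indicator`, file `SLEKappaRhoRestriction`) fed with the bundle and Lemmas 6.2
(`h62`), 6.3 (`h63`); the event is null-measurable.
[cite: LawlerSchrammWerner2003Restriction, end of the proof of Thm. 8.4 (§8.4 p. 38)] -/
theorem measure_hullHitTime_eq_top [Fact Process.isProjectiveLimit_preWienerMeasure]
    (h : PairLeaves ρ W) (h62 : Loewner.restrictionDeriv_exitTime_gt)
    (h63 : IsSmoothHull.restrictionDerivVanishesAtHit) (hAs : IsSmoothHull A) (hA : IsPlusHull A)
    {Φ : ConformalEquiv (upperHalfPlaneSet \ A) upperHalfPlaneSet} (hΦ : IsRestrictionMap A Φ)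
    {d : ℝ} (hd : HasRestrictionDeriv A Φ d) :
    NullMeasurableSet {ω | Loewner.hullHitTime (fun s ↦ W s ω) A = ⊤} preWienerMeasure ∧
      preWienerMeasure {ω | Loewner.hullHitTime (fun s ↦ W s ω) A = ⊤} =
        ENNReal.ofReal (d ^ sleKappaRhoExponent ρ) := by
  obtain ⟨M, hMω⟩ := h.exists_martingale hAs hA
  exact hMω.measure_hullHitTime_eq_top_of_tendsto hΦ hd
    (hMω.ae_tendsto_indicator h62 (h63 hAs hA.1) hA h.ae_continuous h.apply_zero h.ae_not_isBounded
      h.ae_swallowingTime_eq_top)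

/-- **The hulls do not accumulate on the positive axis: `P[cl K_∞ ∩ [a, b] ≠ ∅] = 0`** for
`0 < a < b`, per driving process — the half-ellipse argument of
`SLEKappaRho.measure_closure_hullUnion_inter_realSeg` (`SLEKappaRhoRestriction`; [LSW] end of the
proof of Thm. 7.3, §7.2 p. 29, run with the hulls of `EllipseHulls` and Lemma 2.1): a point of
`[a, b]` in `cl K_∞` puts a hull point inside a smooth `𝒬₊`-hull `J ⊇ B(a, b; ρ₀)` with
`Φ_J'(0) > 1 − η`, an event of probability `1 − Φ_J'(0)^α ≤ 1 − (1 − η)^α → 0`.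
[cite: LawlerSchrammWerner2003Restriction, end of the proof of Thm. 7.3 (§7.2 p. 29) and proof of Thm. 8.4, last paragraph (§8.4)] -/
theorem measure_closure_hullUnion_inter_realSeg [Fact Process.isProjectiveLimit_preWienerMeasure]
    (h : PairLeaves ρ W) (h62 : Loewner.restrictionDeriv_exitTime_gt)
    (h63 : IsSmoothHull.restrictionDerivVanishesAtHit) (hρ : -2 < ρ) {a b : ℝ} (ha : 0 < a)
    (hab : a < b) :
    preWienerMeasure {ω | ¬ Disjoint (closure (Loewner.hullUnion fun s ↦ W s ω)) (realSeg a b)} = 0 := by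
  set S : Set (ℝ≥0 → ℝ) :=
    {ω | ¬ Disjoint (closure (Loewner.hullUnion fun s ↦ W s ω)) (realSeg a b)} with hS
  have hα : 0 < sleKappaRhoExponent ρ := sleKappaRhoExponent_pos hρ
  -- Step 1: for every `η ∈ (0, 1)`, `P S ≤ 1 - (1 - η)^α`
  have hstep : ∀ η : ℝ, 0 < η → η < 1 →
      preWienerMeasure S ≤ 1 - ENNReal.ofReal ((1 - η) ^ sleKappaRhoExponent ρ) := by
    intro η hη hη1
    -- a half-ellipse hull around `[a, b]` with derivative `> 1 - η/2`
    obtain ⟨ρ₀, hρ₀0, hρ₀1, hB, hder⟩ : ∃ ρ₀ : ℝ, 0 < ρ₀ ∧ ρ₀ < 1 ∧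
        ellH a b * jLevel ρ₀ < ellC a b ∧ 1 - η / 2 < ellDeriv a b ρ₀ := by
      have h1 : ∀ᶠ r in 𝓝[<] (1 : ℝ), 0 < r := by
        have : Ioo (0 : ℝ) 1 ∈ 𝓝[<] (1 : ℝ) := Ioo_mem_nhdsLT one_pos
        filter_upwards [this] with r hr using hr.1
      have h2 : ∀ᶠ r in 𝓝[<] (1 : ℝ), r < 1 := eventually_nhdsWithin_of_forall fun r hr ↦ hr
      have h3 : ∀ᶠ r in 𝓝[<] (1 : ℝ), ellH a b * jLevel r < ellC a b := by
        have hlim : Tendsto (fun r ↦ ellH a b * jLevel r) (𝓝[<] (1 : ℝ)) (𝓝 (ellH a b * 2)) :=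
          (tendsto_jLevel_one.mono_left nhdsWithin_le_nhds).const_mul _
        have hlt : ellH a b * 2 < ellC a b := by rw [ellH, ellC]; linarith
        exact hlim (Iio_mem_nhds hlt)
      have h4 : ∀ᶠ r in 𝓝[<] (1 : ℝ), 1 - η / 2 < ellDeriv a b r := by
        have hlim : Tendsto (ellDeriv a b) (𝓝[<] (1 : ℝ)) (𝓝 1) := by
          have := (tendsto_ellDeriv a b).mono_left (nhdsWithin_le_nhds (s := Iio (1 : ℝ)))
          rwa [ellDeriv_one hab ha] at this
        exact hlim (Ioi_mem_nhds (by linarith))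
      obtain ⟨r, hr1, hr2, hr3, hr4⟩ := (h1.and (h2.and (h3.and h4))).exists
      exact ⟨r, hr1, hr2, hr3, hr4⟩
    set B : Set ℂ := ellHull a b ρ₀ with hBdef
    have hBp : IsPlusHull B := isPlusHull_ellHull hab hρ₀0 hρ₀1 hB
    have hBne : B.Nonempty := ⟨a, realSeg_subset_ellRegion hab hρ₀0 hρ₀1
      (ofReal_mem_realSeg.2 left_mem_uIcc), by simp⟩
    -- Lemma 2.1: smooth `+`-hulls `J n ↓ F ⊇ B` with `Φ'_{J n}(0) → Φ_B'(0)`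
    obtain ⟨J, F, hJs, hJp, hJm, hJi, hBF, -, -, hconv⟩ :=
      IsPlusHull.exists_antitone_isSmoothHull_holds hBp hBne
    have hdata : ∀ n, ∃ (Ψ : ConformalEquiv (upperHalfPlaneSet \ J n) upperHalfPlaneSet) (e : ℝ),
        IsRestrictionMap (J n) Ψ ∧ HasRestrictionDeriv (J n) Ψ e := fun n ↦ by
      obtain ⟨Ψ, hΨ, -⟩ := IsStarHull.existsUnique_isRestrictionMap_holds (hJp n).1
      obtain ⟨e, -, -, he⟩ := IsStarHull.exists_hasRestrictionDeriv_holds (hJp n).1 hΨ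
      exact ⟨Ψ, e, hΨ, he⟩
    choose Ψ dn hΨ hdn using hdata
    obtain ⟨-, hlim⟩ := hconv (isRestrictionMap_ellConf hab hρ₀0 hρ₀1 hB)
      (hasRestrictionDeriv_ellConf hab hρ₀0 hρ₀1 hB) hΨ hdn
    obtain ⟨n, hn⟩ := (hlim.eventually (Ioi_mem_nhds hder)).exists
    have hdn1 : 1 - η < dn n := by linarith [hn.le, show 1 - η / 2 ≤ dn n from hn.le]
    -- `S ⊆ {T_{J n} ≠ ⊤}`
    have hδ : 0 < ellH a b * (jLevel ρ₀ - 2) :=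
      mul_pos (ellH_pos hab) (by linarith [two_lt_jLevel hρ₀0 hρ₀1])
    have hSsub : S ⊆ {ω | Loewner.hullHitTime (fun s ↦ W s ω) (J n) = ⊤}ᶜ := by
      intro ω hω hT
      simp only [hS, mem_setOf_eq, Set.not_disjoint_iff] at hω
      obtain ⟨z, hzcl, hzseg⟩ := hω
      obtain ⟨w, hw, hwz⟩ := Metric.mem_closure_iff.1 hzcl _ hδ
      obtain ⟨t, hwt⟩ := mem_iUnion.1 hw
      have hwB : w ∈ B := by
        refine ⟨mem_ellRegion_of_infDist_lt hab le_rfl ?_,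
          show 0 ≤ w.im from le_of_lt (Loewner.hull_subset _ t hwt)⟩
        rw [dist_comm] at hwz
        exact (infDist_le_dist_of_mem hzseg).trans_lt hwz
      have hwJ : w ∈ J n := (hBF.trans (hJi ▸ iInter_subset J n)) hwB
      have hdisj := Loewner.hullHitTime_eq_top_iff.1 (by exact hT) t
      exact Set.disjoint_left.1 hdisj (Loewner.hull_subset_closedHull _ t hwt) hwJ
    -- the measure bound
    obtain ⟨hnull, hPJ⟩ := h.measure_hullHitTime_eq_top h62 h63 (hJs n) (hJp n) (hΨ n) (hdn n)
    calc preWienerMeasure S ≤ preWienerMeasure {ω | Loewner.hullHitTime (fun s ↦ W s ω) (J n) = ⊤}ᶜ :=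
          measure_mono hSsub
      _ = 1 - ENNReal.ofReal (dn n ^ sleKappaRhoExponent ρ) := by
          rw [prob_compl_eq_one_sub₀ hnull, hPJ]
      _ ≤ 1 - ENNReal.ofReal ((1 - η) ^ sleKappaRhoExponent ρ) := by
          gcongr 1 - ENNReal.ofReal ?_
          exact Real.rpow_le_rpow (by linarith) hdn1.le hα.le
  -- Step 2: `1 - (1 - η)^α → 0` as `η → 0`
  have htend : Tendsto (fun k : ℕ ↦ 1 - ENNReal.ofReal ((1 - 1 / ((k : ℝ) + 2)) ^ sleKappaRhoExponent ρ))
      atTop (𝓝 0) := by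
    have h1 : Tendsto (fun k : ℕ ↦ 1 - 1 / ((k : ℝ) + 2)) atTop (𝓝 1) := by
      have : Tendsto (fun k : ℕ ↦ 1 / ((k : ℝ) + 2)) atTop (𝓝 0) :=
        tendsto_const_nhds.div_atTop
          (tendsto_atTop_add_const_right _ _ tendsto_natCast_atTop_atTop)
      simpa using tendsto_const_nhds.sub this
    have h2 : Tendsto (fun k : ℕ ↦ (1 - 1 / ((k : ℝ) + 2)) ^ sleKappaRhoExponent ρ) atTop (𝓝 1) := by
      have := h1.rpow_const (p := sleKappaRhoExponent ρ) (Or.inr hα.le)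
      rwa [Real.one_rpow] at this
    have h3 : Tendsto (fun k : ℕ ↦ ENNReal.ofReal ((1 - 1 / ((k : ℝ) + 2)) ^ sleKappaRhoExponent ρ))
        atTop (𝓝 1) := by
      rw [← ENNReal.ofReal_one]
      exact ENNReal.tendsto_ofReal h2
    have h4 := ((ENNReal.continuous_sub_left ENNReal.one_ne_top).tendsto 1).comp h3
    rw [tsub_self] at h4
    exact h4
  refine le_antisymm (ge_of_tendsto' htend fun k ↦ hstep _ (by positivity) ?_) bot_le
  rw [div_lt_one (by positivity)]
  have hk : (0 : ℝ) ≤ k := Nat.cast_nonneg k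
  linarith

/-- **A.s. `cl K_∞ ∩ (0, ∞) = ∅`** (the closure of the union of the open hulls contains no positive
real point), per driving process, from `measure_closure_hullUnion_inter_realSeg` over the rational
intervals (as `SLEKappaRho.ae_ofReal_notMem_closure_hullUnion`, `SLEKappaRhoRestriction`).
[cite: LawlerSchrammWerner2003Restriction, Lemma 8.3 (2)–(3) and Thm. 8.4 (K ∈ Ω₊: K ∩ ℝ = (−∞, 0])] -/
theorem ae_ofReal_notMem_closure_hullUnion [Fact Process.isProjectiveLimit_preWienerMeasure]
    (h : PairLeaves ρ W) (h62 : Loewner.restrictionDeriv_exitTime_gt)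
    (h63 : IsSmoothHull.restrictionDerivVanishesAtHit) (hρ : -2 < ρ) :
    ∀ᵐ ω ∂preWienerMeasure, ∀ x : ℝ, 0 < x →
      (x : ℂ) ∉ closure (Loewner.hullUnion fun s ↦ W s ω) := by
  have hq : ∀ q : ℚ × ℚ, ∀ᵐ ω ∂preWienerMeasure, (0 : ℝ) < q.1 → (q.1 : ℝ) < q.2 →
      Disjoint (closure (Loewner.hullUnion fun s ↦ W s ω)) (realSeg q.1 q.2) := by
    intro q
    by_cases hq : (0 : ℝ) < q.1 ∧ (q.1 : ℝ) < q.2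
    · have h0 := h.measure_closure_hullUnion_inter_realSeg h62 h63 hρ hq.1 hq.2
      filter_upwards [measure_eq_zero_iff_ae_notMem.1 h0] with ω hω _ _ using not_not.1 hω
    · exact Eventually.of_forall fun ω h1 h2 ↦ absurd ⟨h1, h2⟩ hq
  rw [← ae_all_iff] at hq
  filter_upwards [hq] with ω hω x hx hxcl
  obtain ⟨q₁, hq₁0, hq₁x⟩ := exists_rat_btwn hx
  obtain ⟨q₂, hxq₂, -⟩ := exists_rat_btwn (lt_add_one x)
  have hdisj := hω (q₁, q₂) (by exact_mod_cast hq₁0) (hq₁x.trans hxq₂)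
  refine Set.disjoint_left.1 hdisj hxcl (ofReal_mem_realSeg.2 ?_)
  rw [uIcc_of_le (hq₁x.trans hxq₂).le]
  exact ⟨hq₁x.le, hxq₂.le⟩

/-- **A.s. on `{T_A = ∞}` the hulls do not accumulate on `A`: `cl(⋃_t K_t) ∩ A = ∅`**, for a
smooth hull `A ∈ 𝒬₊`, per driving process — the closure paragraph of the proof of [LSW] Thm. 8.4
by the argument of `SLEKappaRho.ae_disjoint_closure_of_hullHitTime_eq_top`
(`SLEKappaRhoRestrictionProofs`): [LSW]'s outer hulls `E_δ` (`IsSlitHull.arcHull`) are smooth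
hulls of `𝒬₊` containing a uniform `ℍ̄`-neighbourhood of `A` (`IsSlitHull.exists_forall_mem_arcHull`),
so a point of `cl K_∞ ∩ A` forces `T_{E_δ} < ∞`, while
`P[T_A = ∞] − P[T_{E_δ} = ∞] = Φ_A'(0)^α − Φ'_{E_δ}(0)^α → 0` (`measure_hullHitTime_eq_top` twice,
`IsSlitHull.tendsto_restrictionDeriv_arcHull`).
[cite: LawlerSchrammWerner2003Restriction, proof of Thm. 8.4, last paragraph (§8.4 p. 38), with the end of the proof of Thm. 7.3 (§7.2)] -/
theorem ae_disjoint_closure_of_hullHitTime_eq_top [Fact Process.isProjectiveLimit_preWienerMeasure]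
    (h : PairLeaves ρ W) (h62 : Loewner.restrictionDeriv_exitTime_gt)
    (h63 : IsSmoothHull.restrictionDerivVanishesAtHit) (hρ : -2 < ρ) (hAs : IsSmoothHull A)
    (hA : IsPlusHull A) :
    ∀ᵐ ω ∂preWienerMeasure, Loewner.hullHitTime (fun s ↦ W s ω) A = ⊤ →
      Disjoint (closure (⋃ t, Loewner.closedHull (fun s ↦ W s ω) t)) A := by
  rcases A.eq_empty_or_nonempty with rfl | hne
  · exact Eventually.of_forall fun ω _ ↦ Set.disjoint_empty _
  -- [LSW]'s hulls `E_δ` around `A`: smooth hulls of `𝒬₊`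
  have hsl := hA.isSlitHull hne
  have h0 : 0 < min (sInf (realTrace A) / 2) (sSup (realTrace A)) := by
    have hT : IsCompact (realTrace A) := isCompact_realTrace hA.1.isBoundedHull.isCompact
    have hTne : (realTrace A).Nonempty := hA.1.isBoundedHull.realTrace_nonempty hne
    have hm : sInf (realTrace A) ∈ realTrace A := hT.sInf_mem hTne
    have hm0 : 0 < sInf (realTrace A) := hA.2 _ hm
    have hmM : sInf (realTrace A) ≤ sSup (realTrace A) := le_csSup hT.bddAbove hm
    exact lt_min (by linarith) (by linarith)
  set J : ℕ → Set ℂ := fun n ↦ hsl.arcHull (hsl.deltaSeq n) with hJ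
  have hJs : ∀ n, IsSmoothHull (J n) := fun n ↦
    hsl.isSmoothHull_arcHull (hsl.deltaSeq_pos h0 n) (hsl.two_mul_deltaSeq_lt h0 n)
  have hJp : ∀ n, IsPlusHull (J n) := fun n ↦
    hsl.isPlusHull_arcHull h0 (hsl.deltaSeq_pos h0 n) (hsl.two_mul_deltaSeq_lt h0 n)
  -- restriction data of `A` and of the `J n`; `Φ'_{J n}(0) → Φ'_A(0)`
  obtain ⟨Φ, hΦ, -⟩ := IsStarHull.existsUnique_isRestrictionMap_holds hA.1
  obtain ⟨d, -, -, hd⟩ := IsStarHull.exists_hasRestrictionDeriv_holds hA.1 hΦ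
  have hdata : ∀ n, ∃ (Ψ : ConformalEquiv (upperHalfPlaneSet \ J n) upperHalfPlaneSet) (e : ℝ),
      IsRestrictionMap (J n) Ψ ∧ HasRestrictionDeriv (J n) Ψ e := fun n ↦ by
    obtain ⟨Ψ, hΨ, -⟩ := IsStarHull.existsUnique_isRestrictionMap_holds (hJp n).1
    obtain ⟨e, -, -, he⟩ := IsStarHull.exists_hasRestrictionDeriv_holds (hJp n).1 hΨ
    exact ⟨Ψ, e, hΨ, he⟩
  choose Ψ dn hΨ hdn using hdata
  have hlim : Tendsto dn atTop (𝓝 d) := hsl.tendsto_restrictionDeriv_arcHull h0 hΦ hΨ hd hdn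
  -- the events `{T_{J n} = ∞} ⊆ {T_A = ∞}` and their probabilities
  set E : Set (ℝ≥0 → ℝ) := {ω | Loewner.hullHitTime (fun s ↦ W s ω) A = ⊤} with hE
  set En : ℕ → Set (ℝ≥0 → ℝ) := fun n ↦
    {ω | Loewner.hullHitTime (fun s ↦ W s ω) (J n) = ⊤} with hEn
  have hPE : preWienerMeasure E = ENNReal.ofReal (d ^ sleKappaRhoExponent ρ) :=
    (h.measure_hullHitTime_eq_top h62 h63 hAs hA hΦ hd).2
  have hPEn : ∀ n, NullMeasurableSet (En n) preWienerMeasure ∧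
      preWienerMeasure (En n) = ENNReal.ofReal (dn n ^ sleKappaRhoExponent ρ) := fun n ↦
    h.measure_hullHitTime_eq_top h62 h63 (hJs n) (hJp n) (hΨ n) (hdn n)
  have hEnE : ∀ n, En n ⊆ E := by
    intro n ω hω
    have hω' : Loewner.hullHitTime (fun s ↦ W s ω) (J n) = ⊤ := hω
    show Loewner.hullHitTime (fun s ↦ W s ω) A = ⊤
    rw [Loewner.hullHitTime_eq_top_iff] at hω' ⊢
    exact fun t ↦ (hω' t).mono_right hsl.subset_arcHull
  -- the bad event lies in `{T_A = ∞} ∖ {T_{J n} = ∞}` for every `n`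
  set B : Set (ℝ≥0 → ℝ) := {ω | Loewner.hullHitTime (fun s ↦ W s ω) A = ⊤ ∧
    ¬ Disjoint (closure (⋃ t, Loewner.closedHull (fun s ↦ W s ω) t)) A} with hB
  have hBsub : ∀ n, B ⊆ E \ En n := by
    rintro n ω ⟨hT, hcl⟩
    refine ⟨hT, fun hTn ↦ hcl ?_⟩
    have hTn' : Loewner.hullHitTime (fun s ↦ W s ω) (J n) = ⊤ := hTn
    obtain ⟨η, hη, hηJ⟩ := hsl.exists_forall_mem_arcHull (hsl.deltaSeq_pos h0 n)
    refine Set.disjoint_left.2 fun z hzcl hzA ↦ ?_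
    obtain ⟨w, hw, hzw⟩ := Metric.mem_closure_iff.1 hzcl η hη
    obtain ⟨t, hwt⟩ := mem_iUnion.1 hw
    have hwJ : w ∈ J n :=
      hηJ w hwt.1 ((infDist_le_dist_of_mem hzA).trans_lt (by rwa [dist_comm]))
    exact Set.disjoint_left.1 (Loewner.hullHitTime_eq_top_iff.1 hTn' t) hwt hwJ
  -- hence it is null: `P[B] ≤ Φ_A'(0)^α − Φ'_{J n}(0)^α → 0`
  have hPB : preWienerMeasure B = 0 := by
    refine le_antisymm ?_ bot_le
    have h3 : Tendsto (fun n ↦ ENNReal.ofReal (dn n ^ sleKappaRhoExponent ρ)) atTop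
        (𝓝 (ENNReal.ofReal (d ^ sleKappaRhoExponent ρ))) :=
      ENNReal.tendsto_ofReal (hlim.rpow_const (Or.inr (sleKappaRhoExponent_pos hρ).le))
    have htend : Tendsto (fun n ↦ ENNReal.ofReal (d ^ sleKappaRhoExponent ρ) -
        ENNReal.ofReal (dn n ^ sleKappaRhoExponent ρ)) atTop (𝓝 0) := by
      have h4 := ((ENNReal.continuous_sub_left
        (ENNReal.ofReal_ne_top (r := d ^ sleKappaRhoExponent ρ))).tendsto
        (ENNReal.ofReal (d ^ sleKappaRhoExponent ρ))).comp h3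
      rw [tsub_self] at h4
      exact h4
    refine ge_of_tendsto' htend fun n ↦ ?_
    calc preWienerMeasure B ≤ preWienerMeasure (E \ En n) := measure_mono (hBsub n)
      _ = preWienerMeasure E - preWienerMeasure (En n) :=
          measure_sdiff (hEnE n) (hPEn n).1 (measure_ne_top _ _)
      _ = ENNReal.ofReal (d ^ sleKappaRhoExponent ρ) -
            ENNReal.ofReal (dn n ^ sleKappaRhoExponent ρ) := by rw [hPE, (hPEn n).2]
  rw [measure_eq_zero_iff_ae_notMem] at hPB
  filter_upwards [hPB] with ω hω hT
  by_contra hcl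
  exact hω ⟨hT, hcl⟩

/-- **Thm. 8.4 (avoidance form) for a SMOOTH hull `A ∈ 𝒬₊`, per driving process**:
`P[F^{ℝ₊}_ℍ(cl K_∞) ∩ A = ∅] = Φ_A'(0)^α` and the event is null-measurable — from
`P[T_A = ∞] = Φ_A'(0)^α` and the a.s. identity of the two events
(`IsPlusHull.disjoint_sleKappaRhoFill_iff` with Lemma 8.3 (2) and the closure paragraph).
[cite: LawlerSchrammWerner2003Restriction, Thm. 8.4 (p. 37) and its proof (§8.4), smooth hulls] -/
theorem measure_fill_disjoint_of_isSmoothHull [Fact Process.isProjectiveLimit_preWienerMeasure]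
    (h : PairLeaves ρ W) (h62 : Loewner.restrictionDeriv_exitTime_gt)
    (h63 : IsSmoothHull.restrictionDerivVanishesAtHit) (hρ : -2 < ρ) (hAs : IsSmoothHull A)
    (hA : IsPlusHull A) {Φ : ConformalEquiv (upperHalfPlaneSet \ A) upperHalfPlaneSet}
    (hΦ : IsRestrictionMap A Φ) {d : ℝ} (hd : HasRestrictionDeriv A Φ d) :
    NullMeasurableSet {ω | Disjoint (sleKappaRhoFill W ω) A} preWienerMeasure ∧
      preWienerMeasure {ω | Disjoint (sleKappaRhoFill W ω) A} =
        ENNReal.ofReal (d ^ sleKappaRhoExponent ρ) := by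
  obtain ⟨hnull, hP⟩ := h.measure_hullHitTime_eq_top h62 h63 hAs hA hΦ hd
  have hae : {ω | Disjoint (sleKappaRhoFill W ω) A} =ᵐ[preWienerMeasure]
      {ω | Loewner.hullHitTime (fun s ↦ W s ω) A = ⊤} := by
    refine Filter.eventuallyEq_set.2 ?_
    filter_upwards [h.ae_swallowingTime_eq_top,
      h.ae_disjoint_closure_of_hullHitTime_eq_top h62 h63 hρ hAs hA] with ω hsw hclω
    refine hA.disjoint_sleKappaRhoFill_iff hsw ⟨fun hcl ↦ hcl.mono_left subset_closure, fun hK ↦ hclω ?_⟩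
    rw [Loewner.hullHitTime_eq_top_iff]
    exact fun t ↦ hK.mono_left (subset_iUnion _ t)
  exact ⟨hnull.congr hae.symm, by rw [measure_congr hae, hP]⟩

/-- **Thm. 8.4 (avoidance form) for every `A ∈ 𝒬₊`, per driving process**, by [LSW] Lemma 2.1
(as `SLEKappaRho.measure_fill_disjoint_of_leaves`, `SLEKappaRhoRestriction`): with smooth
`+`-hulls `J n ↓ F ⊇ A`, the events `{K ∩ J n = ∅}` increase to `{K ∩ A = ∅}` up to a null set
(no positive real point lies in `K`, `ae_ofReal_notMem_closure_hullUnion`), while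
`Φ'_{J n}(0)^α → Φ_A'(0)^α`.
[cite: LawlerSchrammWerner2003Restriction, Thm. 8.4 (p. 37) with Lemma 2.1 (p. 8)] -/
theorem measure_fill_disjoint [Fact Process.isProjectiveLimit_preWienerMeasure]
    (h : PairLeaves ρ W) (h62 : Loewner.restrictionDeriv_exitTime_gt)
    (h63 : IsSmoothHull.restrictionDerivVanishesAtHit) (hρ : -2 < ρ) (hA : IsPlusHull A)
    {Φ : ConformalEquiv (upperHalfPlaneSet \ A) upperHalfPlaneSet} (hΦ : IsRestrictionMap A Φ)
    {d : ℝ} (hd : HasRestrictionDeriv A Φ d) :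
    preWienerMeasure {ω | Disjoint (sleKappaRhoFill W ω) A} =
      ENNReal.ofReal (d ^ sleKappaRhoExponent ρ) := by
  rcases A.eq_empty_or_nonempty with rfl | hne
  · -- the empty hull: probability one, `Φ_∅'(0) = 1`
    haveI : IsProbabilityMeasure preWienerMeasure := isProbabilityMeasure_preWienerMeasure'
    have hd1 : d = 1 :=
      HasRestrictionDeriv.eq_of_isRestrictionMap IsStarHull.existsUnique_isRestrictionMap_holds
        isStarHull_empty isRestrictionMap_empty hΦ hasRestrictionDeriv_empty hd
    subst hd1
    simp [Real.one_rpow]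
  -- Lemma 2.1
  obtain ⟨J, F, hJs, hJp, hJm, hJi, hAF, hFA, -, hconv⟩ :=
    IsPlusHull.exists_antitone_isSmoothHull_holds hA hne
  have hdata : ∀ n, ∃ (Ψ : ConformalEquiv (upperHalfPlaneSet \ J n) upperHalfPlaneSet) (e : ℝ),
      IsRestrictionMap (J n) Ψ ∧ HasRestrictionDeriv (J n) Ψ e := fun n ↦ by
    obtain ⟨Ψ, hΨ, -⟩ := IsStarHull.existsUnique_isRestrictionMap_holds (hJp n).1
    obtain ⟨e, -, -, he⟩ := IsStarHull.exists_hasRestrictionDeriv_holds (hJp n).1 hΨ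
    exact ⟨Ψ, e, hΨ, he⟩
  choose Ψ dn hΨ hdn using hdata
  obtain ⟨-, hlim⟩ := hconv hΦ hd hΨ hdn
  -- the increasing events `{K ∩ J n = ∅}`
  set E : ℕ → Set (ℝ≥0 → ℝ) := fun n ↦ {ω | Disjoint (sleKappaRhoFill W ω) (J n)} with hE
  have hEn : ∀ n, preWienerMeasure (E n) = ENNReal.ofReal (dn n ^ sleKappaRhoExponent ρ) := fun n ↦
    (h.measure_fill_disjoint_of_isSmoothHull h62 h63 hρ (hJs n) (hJp n) (hΨ n) (hdn n)).2
  have hmono : Monotone E := fun m n hmn ω hω ↦ Disjoint.mono_right (hJm hmn) hω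
  have h1 : Tendsto (preWienerMeasure ∘ E) atTop (𝓝 (preWienerMeasure (⋃ n, E n))) :=
    tendsto_measure_iUnion_atTop hmono
  have h2 : Tendsto (preWienerMeasure ∘ E) atTop
      (𝓝 (ENNReal.ofReal (d ^ sleKappaRhoExponent ρ))) := by
    have : preWienerMeasure ∘ E = fun n ↦ ENNReal.ofReal (dn n ^ sleKappaRhoExponent ρ) := funext hEn
    rw [this]
    exact ENNReal.tendsto_ofReal (hlim.rpow_const (Or.inr (sleKappaRhoExponent_pos hρ).le))
  have hU : preWienerMeasure (⋃ n, E n) = ENNReal.ofReal (d ^ sleKappaRhoExponent ρ) :=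
    tendsto_nhds_unique h1 h2
  -- `{K ∩ A = ∅} = ⋃ₙ {K ∩ J n = ∅}` almost surely
  have hae : {ω | Disjoint (sleKappaRhoFill W ω) A} =ᵐ[preWienerMeasure] ⋃ n, E n := by
    refine Filter.eventuallyEq_set.2 ?_
    filter_upwards [h.ae_ofReal_notMem_closure_hullUnion h62 h63 hρ] with ω hreal
    simp only [mem_setOf_eq, mem_iUnion, hE]
    constructor
    · intro hω
      -- `K ∩ F = ∅`
      have hKF : Disjoint (sleKappaRhoFill W ω) F := by
        refine Set.disjoint_left.2 fun z hzK hzF ↦ ?_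
        have hzim : 0 ≤ z.im := sleKappaRhoFill_subset W ω hzK
        rcases hzim.lt_or_eq with hpos | hzero
        · exact Set.disjoint_left.1 hω hzK (hFA ⟨hzF, hpos⟩)
        · have hzx : z = ((z.re : ℝ) : ℂ) := Complex.ext (by simp) (by simp [← hzero])
          have hzJ : ((z.re : ℝ) : ℂ) ∈ J 0 := hzx ▸ (hJi ▸ iInter_subset J 0) hzF
          have hxpos : 0 < z.re := (hJp 0).2 z.re hzJ
          have hnot : ((z.re : ℝ) : ℂ) ∉ sleKappaRhoFill W ω :=
            ofReal_notMem_leftFilling hxpos.le (hreal z.re hxpos)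
          exact hnot (hzx ▸ hzK)
      -- the compact `K ∩ J 0` misses some `J n`
      have hC : IsCompact (sleKappaRhoFill W ω ∩ J 0) :=
        (hJp 0).1.isBoundedHull.isCompact.inter_left (isClosed_sleKappaRhoFill W ω)
      obtain ⟨n, hn⟩ := (eventually_disjoint_of_iInter_eq (fun n ↦ (hJp n).1.isBoundedHull.isClosed)
        hJm hJi hC (hKF.mono_left inter_subset_left)).exists
      refine ⟨n, Set.disjoint_left.2 fun z hzK hzJ ↦ ?_⟩
      exact Set.disjoint_left.1 hn ⟨hzK, hJm (Nat.zero_le n) hzJ⟩ hzJ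
    · rintro ⟨n, hn⟩
      exact hn.mono_right (hAF.trans (hJi ▸ iInter_subset J n))
  rw [measure_congr hae, hU]

end SLEKappaRho.PairLeaves

/-! ### The measurable `Ω₊`-valued version and the law, per SLE(8/3, ρ) driving pair -/

namespace IsSLEKappaRhoPair

variable {ρ : ℝ} {O W : ℝ≥0 → (ℝ≥0 → ℝ) → ℝ}

/-- **`K = F^{ℝ₊}_ℍ(cl K_∞)` of an SLE(8/3, ρ) driving pair is a random element of `Ω₊`**, given
a.s. continuity of the paths of `W` and the a.s. absence of positive real points in `cl K_∞`
(as `SLEKappaRho.exists_measurable_fill_version_of_leaves`, `SLEKappaRhoFillVersion`, whose proof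
is followed verbatim; Lemma 8.3 (4) is the tree's `SLEKappaRho.not_isBounded_hullUnion_holds`):
there is a measurable `Kc : (ℝ≥0 → ℝ) → Ω₊` (avoidance σ-field) with `Kc = F^{ℝ₊}_ℍ(cl K_∞)` a.s.
[cite: LawlerSchrammWerner2003Restriction, Thm. 8.4 (p. 37) with §8.1 (p. 31), Lemma 8.3 (p. 36), §8.3 (p. 36)] -/
theorem exists_measurable_fill_version_of (hρ : -2 < ρ) (hOW : IsSLEKappaRhoPair (8 / 3) ρ O W)
    (hWc : ∀ᵐ ω ∂preWienerMeasure, Continuous fun t ↦ W t ω)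
    (hreal : ∀ᵐ ω ∂preWienerMeasure, ∀ x : ℝ, 0 < x →
      (x : ℂ) ∉ closure (Loewner.hullUnion fun t ↦ W t ω)) :
    ∃ Kc : (ℝ≥0 → ℝ) → RightConfig, Measurable Kc ∧
      ∀ᵐ ω ∂preWienerMeasure, (Kc ω : Set ℂ) = sleKappaRhoFill W ω := by
  classical
  have hκ : (0 : ℝ≥0) < 8 / 3 := by norm_num
  have h2 := SLEKappaRho.not_isBounded_hullUnion_holds hκ hρ hOW
  obtain ⟨X, hX, hO, hW⟩ := id hOW
  obtain ⟨Z, hZ, hXZ⟩ := id hX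
  have hXae : ∀ᵐ ω ∂preWienerMeasure, Continuous fun t ↦ X t ω := by
    filter_upwards [IsStrongSolution.ae_continuous hZ] with ω hZc
    have : (fun t ↦ X t ω) = fun t ↦ Real.sqrt (Z t ω) := funext fun t ↦ hXZ t ω
    rw [this]
    exact Real.continuous_sqrt.comp hZc
  -- the good samples: continuous `W` and `X`, no positive point in `cl K_∞`, `K_∞` unbounded
  have hgood : ∀ᵐ ω ∂preWienerMeasure, (Continuous (fun t ↦ W t ω) ∧ Continuous (fun t ↦ X t ω)) ∧
      (∀ x : ℝ, 0 < x → (x : ℂ) ∉ closure (Loewner.hullUnion fun t ↦ W t ω)) ∧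
      ¬ IsBounded (Loewner.hullUnion fun t ↦ W t ω) := by
    filter_upwards [hWc, hXae, hreal, h2] with ω h hx h' h''
    exact ⟨⟨h, hx⟩, h', h''⟩
  rw [ae_iff] at hgood
  obtain ⟨N, hNsub, hNm, hN0⟩ := exists_measurable_superset_of_null hgood
  set G : Set (ℝ≥0 → ℝ) := Nᶜ with hGdef
  have hGm : MeasurableSet G := hNm.compl
  have hG : ∀ ω ∈ G, (Continuous (fun t ↦ W t ω) ∧ Continuous (fun t ↦ X t ω)) ∧
      (∀ x : ℝ, 0 < x → (x : ℂ) ∉ closure (Loewner.hullUnion fun t ↦ W t ω)) ∧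
      ¬ IsBounded (Loewner.hullUnion fun t ↦ W t ω) := fun ω hω ↦ by
    by_contra hcon
    exact hω (hNsub hcon)
  have hGae : ∀ᵐ ω ∂preWienerMeasure, ω ∈ G := by
    rw [ae_iff]
    have : {ω : ℝ≥0 → ℝ | ¬ω ∈ G} = N := by
      ext ω
      simp [hGdef]
    rw [this]
    exact hN0
  -- `F = cl K_∞(ω)` is left-fillable on `G`
  have hfill : ∀ ω ∈ G, leftFilling (closure (Loewner.hullUnion fun t ↦ W t ω)) ∈ rightConfigs := by
    intro ω hω
    obtain ⟨⟨hc, -⟩, hpos, hunb⟩ := hG ω hω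
    have h0 : (0 : ℂ) ∈ closure (Loewner.hullUnion fun t ↦ W t ω) := by
      have := Loewner.ofReal_driving_mem_closure_hullUnion hc
      rwa [hOW.snd_zero ω, Complex.ofReal_zero] at this
    exact leftFilling_mem_rightConfigs isClosed_closure (Loewner.closure_hullUnion_subset _)
      (Loewner.isConnected_closure_hullUnion hc) h0 (fun hb ↦ hunb (hb.subset subset_closure)) hpos
  -- the version
  let Kc : (ℝ≥0 → ℝ) → RightConfig := fun ω ↦
    if hω : ω ∈ G then ⟨leftFilling (closure (Loewner.hullUnion fun t ↦ W t ω)), hfill ω hω⟩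
    else RightConfig.negAxis
  refine ⟨Kc, ?_, ?_⟩
  swap
  · filter_upwards [hGae] with ω hω
    simp only [Kc, hω, dif_pos]
    rfl
  -- the regularised driving function as a random element of path space
  let Φ : (ℝ≥0 → ℝ) → C(ℝ≥0, ℝ) := fun ω ↦
    if hω : ω ∈ G then ⟨fun t ↦ W t ω, (hG ω hω).1.1⟩ else 0
  have hΦ_apply : ∀ ω s, Φ ω s = if ω ∈ G then W s ω else 0 := fun ω s ↦ by
    by_cases hω : ω ∈ G
    · simp only [Φ, hω, dif_pos, if_true]
      rfl
    · simp only [Φ, hω, dif_neg, if_false, not_false_eq_true]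
      rfl
  have hΦG : ∀ ω ∈ G, (Φ ω : ℝ≥0 → ℝ) = fun t ↦ W t ω := fun ω hω ↦ by
    funext s
    rw [hΦ_apply, if_pos hω]
  have hΦm : ∀ s, Measurable fun ω ↦ Φ ω s := fun s ↦ by
    have : (fun ω ↦ Φ ω s) = G.indicator (W s) := by
      funext ω
      rw [hΦ_apply, indicator_apply]
    rw [this]
    exact IsSLEKappaRhoPair.measurable_indicator_apply hX hO hW hGm (fun ω hω ↦ (hG ω hω).1.2) s
  -- measurability of `Kc` on the generating events
  refine measurable_generateFrom ?_
  rintro _ ⟨A, hA, rfl⟩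
  have hAc : IsCompact A := hA.1.isBoundedHull.isCompact
  have hrep : Kc ⁻¹' RightConfig.avoid A =
      (G ∩ {ω | Disjoint (closure (Loewner.hullUnion (Φ ω))) A}) ∪ Gᶜ := by
    ext ω
    simp only [mem_preimage, RightConfig.mem_avoid, mem_union, mem_inter_iff, mem_setOf_eq,
      mem_compl_iff]
    by_cases hω : ω ∈ G
    · simp only [Kc, hω, dif_pos, true_and, not_true_eq_false, or_false]
      show Disjoint (leftFilling (closure (Loewner.hullUnion fun t ↦ W t ω))) A ↔ _
      rw [disjoint_leftFilling_iff_of_isPlusHull (hG ω hω).2.1 hA, hΦG ω hω]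
    · simp only [Kc, hω, dif_neg, not_false_eq_true, false_and, or_true, iff_true]
      exact hA.disjoint_nonposAxis.symm
  rw [hrep]
  exact (hGm.inter (Loewner.measurableSet_setOf_disjoint_closure_hullUnion hΦm hAc)).union hGm.compl

/-- **[LSW] Thm. 8.4 in law form, per SLE(8/3, ρ) driving pair**: given the bundle
`SLEKappaRho.PairLeaves ρ W` and Lemmas 6.2 and 6.3, the random set `F^{ℝ₊}_ℍ(cl K_∞)` has a
measurable `Ω₊`-valued version whose law is the right-sided restriction measure `P⁺_{α(ρ)}`
(the measurable version of `exists_measurable_fill_version_of` and the avoidance formula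
`PairLeaves.measure_fill_disjoint`, combined as in `SLEKappaRho.isRightRestrictionMeasure_fill_of`).
[cite: LawlerSchrammWerner2003Restriction, Thm. 8.4 (p. 37) with §8.1 (p. 31) and its proof (§8.4)] -/
theorem isRightRestrictionMeasure_map_of (hρ : -2 < ρ) (hOW : IsSLEKappaRhoPair (8 / 3) ρ O W)
    (h : SLEKappaRho.PairLeaves ρ W) (h62 : Loewner.restrictionDeriv_exitTime_gt)
    (h63 : IsSmoothHull.restrictionDerivVanishesAtHit) :
    ∃ Kc : (ℝ≥0 → ℝ) → RightConfig, Measurable Kc ∧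
      (∀ᵐ ω ∂preWienerMeasure, (Kc ω : Set ℂ) = sleKappaRhoFill W ω) ∧
        IsRightRestrictionMeasure (sleKappaRhoExponent ρ) (preWienerMeasure.map Kc) := by
  haveI : Fact Process.isProjectiveLimit_preWienerMeasure := ⟨isProjectiveLimit_preWienerMeasure_holds⟩
  obtain ⟨Kc, hKc, hae⟩ := hOW.exists_measurable_fill_version_of hρ h.ae_continuous
    (h.ae_ofReal_notMem_closure_hullUnion h62 h63 hρ)
  haveI : IsProbabilityMeasure preWienerMeasure := isProbabilityMeasure_preWienerMeasure'
  refine ⟨Kc, hKc, hae, Measure.isProbabilityMeasure_map hKc.aemeasurable, ?_⟩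
  intro A hA Φ hΦ d hd
  rw [Measure.map_apply hKc (RightConfig.measurableSet_avoid hA),
    measure_congr (SLEKappaRho.preimage_avoid_ae_eq hae A)]
  exact h.measure_fill_disjoint h62 h63 hρ hA hΦ hd

end IsSLEKappaRhoPair

/-! ### [LSW] Theorem 8.4 from the weakest leaves -/

/-- **`K` is a random element of `Ω₊`, from the weak leaves**: the named fact
`SLEKappaRho.exists_measurable_fill_version` from `∫₀ᵗ du/Z_u < ∞` (§8.3), the martingale of
Lemmas 8.9–8.10, Lemma 6.2, Lemma 6.3 and Lemma 8.3 (2) on the positive axis.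
[cite: LawlerSchrammWerner2003Restriction, Thm. 8.4 (p. 37) with §8.1 (p. 31), Lemma 8.3 (p. 36), §8.3 (p. 36)] -/
theorem SLEKappaRho.exists_measurable_fill_version_of_weak_leaves
    (hfin : SLEKappaRho.intervalIntegrable_inv) (hM : SLEKappaRho.exists_isOneSidedMartingale)
    (h62 : Loewner.restrictionDeriv_exitTime_gt) (h63 : IsSmoothHull.restrictionDerivVanishesAtHit)
    (h83 : SLEKappaRho.swallowingTime_ofReal_pos) : SLEKappaRho.exists_measurable_fill_version := by
  haveI : Fact Process.isProjectiveLimit_preWienerMeasure := ⟨isProjectiveLimit_preWienerMeasure_holds⟩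
  intro ρ O W hρ hOW
  have h := SLEKappaRho.pairLeaves_of hfin hM h83 hρ hOW
  exact hOW.exists_measurable_fill_version_of hρ h.ae_continuous
    (h.ae_ofReal_notMem_closure_hullUnion h62 h63 hρ)

/-- **The avoidance formula of Thm. 8.4 from the weak leaves**: the named fact
`SLEKappaRho.measure_fill_disjoint` (`P[F^{ℝ₊}_ℍ(cl K_∞) ∩ A = ∅] = Φ_A'(0)^α`, `A ∈ 𝒬₊`) from
`∫₀ᵗ du/Z_u < ∞` (§8.3), the martingale of Lemmas 8.9–8.10, Lemma 6.2, Lemma 6.3 and Lemma 8.3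
(2) on the positive axis. [cite: LawlerSchrammWerner2003Restriction, Thm. 8.4 (p. 37) and its proof (§8.4)] -/
theorem SLEKappaRho.measure_fill_disjoint_of_weak_leaves
    (hfin : SLEKappaRho.intervalIntegrable_inv) (hM : SLEKappaRho.exists_isOneSidedMartingale)
    (h62 : Loewner.restrictionDeriv_exitTime_gt) (h63 : IsSmoothHull.restrictionDerivVanishesAtHit)
    (h83 : SLEKappaRho.swallowingTime_ofReal_pos) : SLEKappaRho.measure_fill_disjoint := by
  haveI : Fact Process.isProjectiveLimit_preWienerMeasure := ⟨isProjectiveLimit_preWienerMeasure_holds⟩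
  intro ρ O W hρ hOW A hA Φ hΦ d hd
  exact (SLEKappaRho.pairLeaves_of hfin hM h83 hρ hOW).measure_fill_disjoint h62 h63 hρ hA hΦ hd

/-- **[LSW] Theorem 8.4 in law form from the WEAKEST leaves**: the law of the `Ω₊`-valued
version of `K = F^{ℝ₊}_ℍ(cl K_∞)` for SLE(8/3, ρ), `ρ > −2`, is the right-sided restriction
measure `P⁺_{α(ρ)}`, `α(ρ) = (3ρ + 10)(2 + ρ)/32` (`SLEKappaRho.isRightRestrictionMeasure_fill`),
given: the finiteness `∫₀ᵗ du/Z_u < ∞` of §8.3 (`SLEKappaRho.intervalIntegrable_inv`), the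
one-sided restriction martingale of Lemmas 8.9–8.10 (`SLEKappaRho.exists_isOneSidedMartingale`),
Lemma 6.2 (`Loewner.restrictionDeriv_exitTime_gt`), Lemma 6.3
(`IsSmoothHull.restrictionDerivVanishesAtHit`) and Lemma 8.3 (2) on the positive axis
(`SLEKappaRho.swallowingTime_ofReal_pos`); Lemma 8.3 (4), Lemma 2.1, the closure paragraph,
the existence and uniqueness of `Φ_A`, `Φ_A'(0)` and Kolmogorov's extension being proved in the
tree. [cite: LawlerSchrammWerner2003Restriction, Thm. 8.4 (p. 37) and its proof (§8.4)] -/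
theorem SLEKappaRho.isRightRestrictionMeasure_fill_of_weak_leaves
    (hfin : SLEKappaRho.intervalIntegrable_inv) (hM : SLEKappaRho.exists_isOneSidedMartingale)
    (h62 : Loewner.restrictionDeriv_exitTime_gt) (h63 : IsSmoothHull.restrictionDerivVanishesAtHit)
    (h83 : SLEKappaRho.swallowingTime_ofReal_pos) : SLEKappaRho.isRightRestrictionMeasure_fill :=
  fun hρ hOW ↦ hOW.isRightRestrictionMeasure_map_of hρ (SLEKappaRho.pairLeaves_of hfin hM h83 hρ hOW)
    h62 h63

end Literature.Probability.RandomPlanarGeometry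

end
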